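import Summits.ValiantsHypothesis.ValiantsHypothesis.Theorems.LangWeilTransferTameResolutionNestedDegree
import Summits.ValiantsHypothesis.ValiantsHypothesis.Theorems.LangWeilTransferTameResolutionNestedWeight
import Summits.ValiantsHypothesis.ValiantsHypothesis.Theorems.LangWeilTransferTameResolutionFactorWeightPrelims
import Literature.Computability.AlgebraicComplexity.BurgisserBooleanPartsA3Assembly

/-!
# LangWeilTransfer, support item `TameResolution` (stmt-ValiantsHypothesis-6378) — sizes of the
# graph numerators `W_i` of the ORIGINAL coordinates

Route `LangWeilTransfer` of `ValiantsHypothesis` (conditional route; honest framing: bookkeeping,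
nothing here bears on VP ≠ VNP). Quantitative pass (roadmap note of val-lit-p6 g9, §4 (S), last
item): in `tameResolution_qualitative` the numerator of the original coordinate `y_i` is
`W_i = C(c₀ ρ) + Σ_j C(c_j) V_j ∈ ℤ[T][U]` with `c₀ = coeff_0 (Γ X_i)`, `c_j = coeff_{e_j} (Γ X_i)`.
If the flattening of `Γ X_i` has weight `≤ H`, then `wt c₀, wt c_j ≤ H` and `deg ≤ deg flat(Γ X_i)`
(`LangWeilTransferTameResolutionNestedWeight/Degree`), so the packaged
`(finSuccEquiv ℤ r)⁻¹ W_i = rename succ (c₀ ρ) + Σ_j rename succ c_j · (finSuccEquiv ℤ r)⁻¹ V_j`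
has weight `≤ H (wt ρ + n · max wt V♯)` and total degree `≤ D_Γ + max (deg ρ, deg V♯)`.

* `weight_coeff_le_of_flat`, `W_flat_eq`, `W_sizes`.
-/

noncomputable section

open MvPolynomial
open Literature.Computability.AlgebraicComplexity

-- the summit and the problem share the name `ValiantsHypothesis` (D-0017 single-conjunct layout)
set_option linter.dupNamespace false

namespace Summit.ValiantsHypothesis.ValiantsHypothesis.Theorems.LangWeilTransfer

variable {r n : ℕ}

/-- One nested coefficient weighs at most the flat weight. -/
theorem weight_coeff_le_of_flat (L : MvPolynomial (Fin n) (MvPolynomial (Fin r) ℤ)) (β : Fin n →₀ ℕ) :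
    weight (L.coeff β) ≤ weight ((sumAlgEquiv ℤ (Fin n) (Fin r)).symm L) := by
  classical
  refine le_trans ?_ (sum_weight_coeff_le_weight_flat L)
  by_cases hβ : β ∈ L.support
  · exact Finset.single_le_sum (f := fun β => weight (L.coeff β)) (fun _ _ => Nat.zero_le _) hβ
  · rw [notMem_support_iff.1 hβ, weight_zero]; exact Nat.zero_le _

/-- The packaged numerator: `(finSuccEquiv)⁻¹ (C (c₀ ρ) + Σ_j C c_j · V_j)
= rename succ (c₀ ρ) + Σ_j rename succ c_j · (finSuccEquiv)⁻¹ V_j`. -/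
theorem W_flat_eq (c₀ ρ : MvPolynomial (Fin r) ℤ) (c : Fin n → MvPolynomial (Fin r) ℤ)
    (V : Fin n → Polynomial (MvPolynomial (Fin r) ℤ)) :
    (finSuccEquiv ℤ r).symm (Polynomial.C (c₀ * ρ) + ∑ j, Polynomial.C (c j) * V j) =
      rename Fin.succ (c₀ * ρ) + ∑ j, rename Fin.succ (c j) * (finSuccEquiv ℤ r).symm (V j) := by
  rw [map_add, map_sum, finSuccEquiv_symm_C]
  congr 1
  refine Finset.sum_congr rfl fun j _ => ?_
  rw [map_mul, finSuccEquiv_symm_C]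

/-- **Sizes of the packaged numerators `W♯_i`.** -/
theorem W_sizes (L : MvPolynomial (Fin n) (MvPolynomial (Fin r) ℤ)) {H DΓ Dρ Wρ DV WV : ℕ}
    (hLw : weight ((sumAlgEquiv ℤ (Fin n) (Fin r)).symm L) ≤ H)
    (hLd : ((sumAlgEquiv ℤ (Fin n) (Fin r)).symm L).totalDegree ≤ DΓ)
    (ρ : MvPolynomial (Fin r) ℤ) (hρd : ρ.totalDegree ≤ Dρ) (hρw : weight ρ ≤ Wρ)
    (V : Fin n → Polynomial (MvPolynomial (Fin r) ℤ))
    (hVd : ∀ j, ((finSuccEquiv ℤ r).symm (V j)).totalDegree ≤ DV)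
    (hVw : ∀ j, weight ((finSuccEquiv ℤ r).symm (V j)) ≤ WV) :
    let W := Polynomial.C (L.coeff 0 * ρ) + ∑ j, Polynomial.C (L.coeff (Finsupp.single j 1)) * V j
    ((finSuccEquiv ℤ r).symm W).totalDegree ≤ DΓ + max Dρ DV ∧
      weight ((finSuccEquiv ℤ r).symm W) ≤ H * Wρ + n * (H * WV) := by
  intro W
  have hcw : ∀ β, weight (L.coeff β) ≤ H := fun β => (weight_coeff_le_of_flat L β).trans hLw
  have hcd : ∀ β, (L.coeff β).totalDegree ≤ DΓ := fun β =>
    (totalDegree_coeff_le_totalDegree_flat L β).trans hLd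
  change ((finSuccEquiv ℤ r).symm (Polynomial.C (L.coeff 0 * ρ) + ∑ j, Polynomial.C (L.coeff (Finsupp.single j 1)) * V j)).totalDegree ≤ _ ∧
    weight ((finSuccEquiv ℤ r).symm (Polynomial.C (L.coeff 0 * ρ) + ∑ j, Polynomial.C (L.coeff (Finsupp.single j 1)) * V j)) ≤ _
  rw [W_flat_eq]
  refine ⟨?_, ?_⟩
  · refine (totalDegree_add _ _).trans (max_le ?_ ?_)
    · refine (totalDegree_rename_le _ _).trans ((totalDegree_mul _ _).trans ?_)
      exact Nat.add_le_add (hcd 0) (hρd.trans (le_max_left _ _))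
    · refine totalDegree_finsetSum_le fun j _ => (totalDegree_mul _ _).trans ?_
      exact Nat.add_le_add ((totalDegree_rename_le _ _).trans (hcd _)) ((hVd j).trans (le_max_right _ _))
  · refine (weight_add_le _ _).trans (Nat.add_le_add ?_ ?_)
    · rw [weight_rename_of_injective (Fin.succ_injective r)]
      exact (weight_mul_le _ _).trans (Nat.mul_le_mul (hcw 0) hρw)
    · refine (weight_finset_sum_le _ _).trans ?_
      calc ∑ j, weight (rename Fin.succ (L.coeff (Finsupp.single j 1)) * (finSuccEquiv ℤ r).symm (V j))
          ≤ ∑ _j : Fin n, H * WV := Finset.sum_le_sum fun j _ => by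
              refine (weight_mul_le _ _).trans ?_
              rw [weight_rename_of_injective (Fin.succ_injective r)]
              exact Nat.mul_le_mul (hcw _) (hVw j)
        _ = n * (H * WV) := by rw [Finset.sum_const, Finset.card_univ, Fintype.card_fin, smul_eq_mul]

end Summit.ValiantsHypothesis.ValiantsHypothesis.Theorems.LangWeilTransfer
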